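import Summits.QuantumFields.QCD.Theses.CentreStabilisedCircle

/-!
# Assembly of route CentreStabilisedCircle (item stmt-QuantumFields-9704)

Pure logic: the chain `SmallCircleGap → CircleContinuity → SlabToTorus → OffsetToFull →
ContinuumComplement → QCD`.  Take `reg` and the threshold `M₀ˢ` from `SmallCircleGap`, the
threshold `M₀ᶜ` from `CircleContinuity` at that `reg`; above `max M₀ˢ M₀ᶜ` the window clustering
transports to all circle sizes, `SlabToTorus` turns it into a torus lattice gap, `OffsetToFull`
removes the threshold and `ContinuumComplement` concludes `QCD`.
-/

namespace Summit.QuantumFields.QCD.Theorems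

open Summit.QuantumFields.QCD.Theses.CentreStabilisedCircle

/-- The assembly item of route CentreStabilisedCircle (stmt-QuantumFields-9704): the five route
items imply the conjunct `QCD` by pure logic (threshold `max M₀ˢ M₀ᶜ`). -/
theorem centreStabilisedCircle_assembly_proof : Summit.QuantumFields.QCD.Theses.CentreStabilisedCircle.Assembly := by
  unfold Assembly
  intro hS hC hT hO hU
  refine hU (hO fun Nf hNf => ?_)
  obtain ⟨reg, hms, has, M₀, hM₀, hm⟩ := hS Nf hNf
  obtain ⟨M₁, _hM₁, hc⟩ := hC Nf hNf reg hms has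
  refine ⟨reg, hms, has, max M₀ M₁, le_max_of_le_left hM₀, fun m hmM => ?_⟩
  have h0 : ∀ f, M₀ < m f := fun f => lt_of_le_of_lt (le_max_left _ _) (hmM f)
  have h1 : ∀ f, M₁ < m f := fun f => lt_of_le_of_lt (le_max_right _ _) (hmM f)
  obtain ⟨hbr, hanchor⟩ := hm m h0
  exact ⟨hbr, hT Nf reg m (hc m h1 hbr hanchor)⟩

end Summit.QuantumFields.QCD.Theorems
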